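import Literature.NumberTheory.Automorphic.Liu2021.AppendixC.DefC1toC3
import Mathlib.FieldTheory.PrimitiveElement
import HarnessLib

/-!
# Liu 2021, Appendix C, Def. C.1 / Rem. C.2 / Def. C.3 as printed — companion lemmas (`DefC1toC3Aux`)

Bookkeeping PROVED about the typing of `AppendixC/DefC1toC3.lean` ([Liu2021] = Y. Liu, *Fourier–Jacobi cycles and
arithmetic relative trace formula*, Camb. J. Math. 9 (2021), arXiv:2102.11518; TeX source `FJcycle.tex` md5
`6db49a74122d2cb0f224fa1b39488a0c`, App. C preamble l. 4550 and §C.1 l. 4558–4563).  Nothing here is a result OF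
[Liu2021]; these are the facts that make the as-printed definitions well-posed on the tree's objects:

* `restr_eq_iff`, `restr_conjugate`, `exists_restr_eq`, `eq_or_eq_conjugate_of_restr_eq` — the projection
  `π : Φ_E → Φ_F` (l. 4550) is onto and its fibres are the complex-conjugate pairs (`E/F` a CM extension: every complex
  embedding of `E` over a real embedding of `F` is determined up to conjugation; Mathlib `AlgHom.card` for the quadratic
  extension `E/F` and `IsTotallyComplex.complexEmbedding_not_isReal`);
* `CMType.existsUnique_mem_restr_eq`, `CMType.bijOn_restr` — **«a CM type (of `E`) is a subset `Φ` of `Φ_E` such that `π`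
  induces a bijection from `Φ` to `Φ_F`»** (l. 4550): PROVED for the tree's `Motives.CMType E` (one of each conjugate
  pair), i.e. READING R3 of `DefC1toC3` is an equivalence of definitions, not an interpretation;
* `CMType.above_spec`, `CMType.eq_above`, `CMType.aboveConj_spec`, `CMType.aboveConj_eq_conjugate_above`,
  `CMType.above_injective`, `CMType.aboveConj_injective` — `τ^-` (resp. `τ^+`) IS «the unique element in `Φ` (resp. `Φ^c`)
  whose image under `π` is `τ`» (l. 4563), and `τ^+ = \overline{τ^-}`;
* `HermSpace.sigElt_apply`, `HermSpace.sigFlatElt_apply` — the coefficients of the display (C.1): `sig_{V,Φ}` has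
  coefficient `q_{π φ}` at `φ ∈ Φ` and `p_{π φ}` at `φ ∈ Φ^c`; `sig^♭_{V,Φ}` has `q_{π φ}` at `φ ∈ Φ` and `0` elsewhere;
* `HermSpace.gram_map_conj_transpose` (`(c J)ᵀ = J`), `HermSpace.posIndex_le` / `negIndex_le` (`p_τ, q_τ ≤ n`),
  `HermSpace.mem_rationalPoints_iff`, and `HermSpace.nonempty` (the binder list of `HermSpace` is inhabited by the split
  space `E^{⊕n}`, `(x, y) = Σ x_i c(y_i)` — non-vacuity of the typing, our bookkeeping).

T5: n/a (no hypothesis-binder theorem about [Liu2021]; all statements proved).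

## References

* [Liu2021] Y. Liu, *Fourier–Jacobi cycles and arithmetic relative trace formula*, Camb. J. Math. 9 (2021) 1–147,
  arXiv:2102.11518 — App. C l. 4550, l. 4558–4563, display (C.1), l. 4569–4571.
-/

noncomputable section

open NumberField
open scoped Matrix MatrixGroups
open Literature.AlgebraicGeometry.Motives (CMType)

namespace Literature.NumberTheory.Automorphic.Liu2021.AppendixC

open NumberField.ComplexEmbedding

variable (F E : Type) [Field F] [NumberField F] [IsTotallyReal F] [Field E] [NumberField E] [Algebra F E]
  [IsTotallyComplex E] [Algebra.IsQuadraticExtension F E]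

section Fibre

omit [NumberField F] [NumberField E] [IsTotallyComplex E] [Algebra.IsQuadraticExtension F E] in
/-- `π φ = τ` iff `φ|_F = τ` followed by `ℝ ⊆ ℂ`. [cite: Liu2021, App. C l. 4550] -/
theorem restr_eq_iff (φ : E →+* ℂ) (τ : F →+* ℝ) :
    restr F E φ = τ ↔ φ.comp (algebraMap F E) = Complex.ofRealHom.comp τ := by
  constructor
  · rintro rfl; exact comp_algebraMap_eq_restr F E φ
  · intro h
    have h' := (comp_algebraMap_eq_restr F E φ).symm.trans h
    ext x
    have := congrArg (fun f : F →+* ℂ => f x) h'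
    simpa using this

omit [NumberField F] [NumberField E] [IsTotallyComplex E] [Algebra.IsQuadraticExtension F E] in
/-- Complex-conjugate embeddings have the same restriction to `F`: `π \bar φ = π φ`. [cite: Liu2021, App. C l. 4550] -/
theorem restr_conjugate (φ : E →+* ℂ) : restr F E (conjugate φ) = restr F E φ := by
  rw [restr_eq_iff]
  ext x
  rw [RingHom.comp_apply, RingHom.comp_apply, conjugate_coe_eq, ← restr_apply_coe, Complex.conj_ofReal,
    Complex.ofRealHom_eq_coe]

omit [NumberField F] [NumberField E] [IsTotallyComplex E] in
/-- Every real embedding `τ ∈ Φ_F` lies under some complex embedding of `E` (`π` is onto). [cite: Liu2021, App. C l. 4550] -/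
theorem exists_restr_eq (τ : F →+* ℝ) : ∃ φ : E →+* ℂ, restr F E φ = τ := by
  letI : Algebra F ℂ := (Complex.ofRealHom.comp τ).toAlgebra
  haveI : Module.Finite F E :=
    Module.finite_of_finrank_pos (by rw [Algebra.IsQuadraticExtension.finrank_eq_two F E]; norm_num)
  let f : E →ₐ[F] ℂ := IsAlgClosed.lift
  refine ⟨f.toRingHom, ?_⟩
  rw [restr_eq_iff]
  exact f.comp_algebraMap

/-- The fibre of `π` through `φ₁` is `{φ₁, \bar φ₁}`: two complex embeddings of `E` with the same restriction to `F` are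
equal or complex conjugate (`E/F` quadratic). [cite: Liu2021, App. C l. 4550] -/
theorem eq_or_eq_conjugate_of_restr_eq {φ₁ φ₂ : E →+* ℂ} (h : restr F E φ₂ = restr F E φ₁) :
    φ₂ = φ₁ ∨ φ₂ = conjugate φ₁ := by
  set ψ : F →+* ℂ := Complex.ofRealHom.comp (restr F E φ₁) with hψ
  letI : Algebra F ℂ := ψ.toAlgebra
  haveI : Module.Finite F E :=
    Module.finite_of_finrank_pos (by rw [Algebra.IsQuadraticExtension.finrank_eq_two F E]; norm_num)
  have key : ∀ φ : E →+* ℂ, φ.comp (algebraMap F E) = ψ → ∃ a : E →ₐ[F] ℂ, (a : E →+* ℂ) = φ :=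
    fun φ hφ => ⟨{ φ with commutes' := fun x => congrArg (fun f : F →+* ℂ => f x) hφ }, rfl⟩
  have h1 : φ₁.comp (algebraMap F E) = ψ := comp_algebraMap_eq_restr F E φ₁
  have h2 : (conjugate φ₁).comp (algebraMap F E) = ψ := (restr_eq_iff F E _ _).1 (restr_conjugate F E φ₁)
  have h3 : φ₂.comp (algebraMap F E) = ψ := (restr_eq_iff F E _ _).1 h
  obtain ⟨a₁, ha₁⟩ := key φ₁ h1
  obtain ⟨a₂, ha₂⟩ := key _ h2
  obtain ⟨a, ha⟩ := key φ₂ h3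
  have hne : a₁ ≠ a₂ := by
    intro hyp
    have hr : conjugate φ₁ = φ₁ := by rw [← ha₂, ← hyp]; exact ha₁
    exact IsTotallyComplex.complexEmbedding_not_isReal φ₁ (isReal_iff.2 hr)
  have hcard : Fintype.card (E →ₐ[F] ℂ) = 2 := by
    rw [AlgHom.card F E ℂ, Algebra.IsQuadraticExtension.finrank_eq_two F E]
  by_contra hcon
  rw [not_or] at hcon
  have hb1 : a ≠ a₁ := fun e => hcon.1 (by rw [← ha, ← ha₁, e])
  have hb2 : a ≠ a₂ := fun e => hcon.2 (by rw [← ha, ← ha₂, e])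
  have : 2 < Fintype.card (E →ₐ[F] ℂ) := Fintype.two_lt_card_iff.2 ⟨a, a₁, a₂, hb1, hb2, hne⟩
  omega

/-- **«`π` induces a bijection from `Φ` to `Φ_F`»** (l. 4550) — Liu's phrasing of «CM type», PROVED for the tree's
`CMType E` over the CM extension `E/F`: for every `τ ∈ Φ_F` there is exactly one `φ ∈ Φ` with `π φ = τ`.
[cite: Liu2021, App. C l. 4550] -/
theorem CMType.existsUnique_mem_restr_eq (Φ : CMType E) (τ : F →+* ℝ) :
    ∃! φ : E →+* ℂ, φ ∈ Φ.1 ∧ restr F E φ = τ := by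
  obtain ⟨φ₁, hφ₁⟩ := exists_restr_eq F E τ
  -- one of `φ₁`, `\bar φ₁` lies in `Φ`
  obtain ⟨φ, hφΦ, hφτ⟩ : ∃ φ : E →+* ℂ, φ ∈ Φ.1 ∧ restr F E φ = τ := by
    by_cases hmem : φ₁ ∈ Φ.1
    · exact ⟨φ₁, hmem, hφ₁⟩
    · refine ⟨conjugate φ₁, ?_, by rw [restr_conjugate, hφ₁]⟩
      by_contra hc
      exact hmem ((Φ.2 φ₁).2 hc)
  refine ⟨φ, ⟨hφΦ, hφτ⟩, ?_⟩
  rintro φ' ⟨hφ'Φ, hφ'τ⟩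
  rcases eq_or_eq_conjugate_of_restr_eq F E (φ₁ := φ) (φ₂ := φ') (by rw [hφ'τ, hφτ]) with h | h
  · exact h
  · exact absurd (h ▸ hφ'Φ) ((Φ.2 φ).1 hφΦ)

/-- `π|_Φ : Φ → Φ_F` is a bijection (Liu's definition of CM type, l. 4550), for the tree's `CMType E`.
[cite: Liu2021, App. C l. 4550] -/
theorem CMType.bijOn_restr (Φ : CMType E) : Set.BijOn (restr F E) Φ.1 Set.univ := by
  refine ⟨fun _ _ => Set.mem_univ _, ?_, ?_⟩
  · intro φ hφ φ' hφ' h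
    obtain ⟨ψ, -, huniq⟩ := CMType.existsUnique_mem_restr_eq F E Φ (restr F E φ)
    exact (huniq φ ⟨hφ, rfl⟩).trans (huniq φ' ⟨hφ', h.symm⟩).symm
  · intro τ _
    obtain ⟨φ, ⟨hφ, hτ⟩, -⟩ := CMType.existsUnique_mem_restr_eq F E Φ τ
    exact ⟨φ, hφ, hτ⟩

/-- **Specification of `τ^-`**: `τ^- ∈ Φ` and `π τ^- = τ` (l. 4563). [cite: Liu2021, App. C l. 4563] -/
theorem CMType.above_spec (Φ : CMType E) (τ : F →+* ℝ) :
    CMType.above F E Φ τ ∈ Φ.1 ∧ restr F E (CMType.above F E Φ τ) = τ :=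
  Classical.epsilon_spec (p := fun φ : E →+* ℂ => φ ∈ Φ.1 ∧ restr F E φ = τ)
    (CMType.existsUnique_mem_restr_eq F E Φ τ).exists

/-- **Uniqueness of `τ^-`**: an element of `Φ` above `τ` IS `τ^-` (l. 4563). [cite: Liu2021, App. C l. 4563] -/
theorem CMType.eq_above {Φ : CMType E} {τ : F →+* ℝ} {φ : E →+* ℂ} (hφ : φ ∈ Φ.1) (hτ : restr F E φ = τ) :
    φ = CMType.above F E Φ τ :=
  (CMType.existsUnique_mem_restr_eq F E Φ τ).unique ⟨hφ, hτ⟩ (CMType.above_spec F E Φ τ)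

/-- **Specification of `τ^+`**: `τ^+ ∈ Φ^c` and `π τ^+ = τ` (l. 4563). [cite: Liu2021, App. C l. 4563] -/
theorem CMType.aboveConj_spec (Φ : CMType E) (τ : F →+* ℝ) :
    CMType.aboveConj F E Φ τ ∈ (CMType.conj E Φ).1 ∧ restr F E (CMType.aboveConj F E Φ τ) = τ :=
  Classical.epsilon_spec (p := fun φ : E →+* ℂ => φ ∈ (CMType.conj E Φ).1 ∧ restr F E φ = τ)
    (CMType.existsUnique_mem_restr_eq F E (CMType.conj E Φ) τ).exists

/-- `τ^+ = \overline{τ^-}`: the element of `Φ^c` above `τ` is the complex conjugate of the element of `Φ` above `τ`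
(l. 4563). [cite: Liu2021, App. C l. 4563] -/
theorem CMType.aboveConj_eq_conjugate_above (Φ : CMType E) (τ : F →+* ℝ) :
    CMType.aboveConj F E Φ τ = conjugate (CMType.above F E Φ τ) := by
  obtain ⟨hmem, hτ⟩ := CMType.aboveConj_spec F E Φ τ
  obtain ⟨hmem', hτ'⟩ := CMType.above_spec F E Φ τ
  rcases eq_or_eq_conjugate_of_restr_eq F E (φ₁ := CMType.above F E Φ τ) (φ₂ := CMType.aboveConj F E Φ τ)
      (by rw [hτ, hτ']) with h | h
  · exact absurd (h ▸ hmem') hmem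
  · exact h

/-- `τ^-` for distinct `τ` are distinct (`π τ^- = τ`). [cite: Liu2021, App. C l. 4563] -/
theorem CMType.above_injective (Φ : CMType E) : Function.Injective (CMType.above F E Φ) := fun τ τ' h => by
  rw [← (CMType.above_spec F E Φ τ).2, ← (CMType.above_spec F E Φ τ').2, h]

/-- `τ^+` for distinct `τ` are distinct. [cite: Liu2021, App. C l. 4563] -/
theorem CMType.aboveConj_injective (Φ : CMType E) : Function.Injective (CMType.aboveConj F E Φ) := fun τ τ' h => by
  rw [← (CMType.aboveConj_spec F E Φ τ).2, ← (CMType.aboveConj_spec F E Φ τ').2, h]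

end Fibre

namespace HermSpace

variable {F E}
variable (V : HermSpace F E)

omit [NumberField F] in
/-- The Gram matrix is `c`-hermitian: `(c J)ᵀ = J` (from `form_herm`). [cite: Liu2021, App. C l. 4558] -/
theorem gram_map_conj_transpose : (V.gram.map (conj F E))ᵀ = V.gram := by
  ext i j
  simp [gram, ← V.form_herm]

open Classical in
/-- **Coefficients of `sig_{V,Φ}`** (display (C.1)): the coefficient of `φ ∈ Φ_E` is `q_{π φ}` if `φ ∈ Φ` (`φ = (π φ)^-`)
and `p_{π φ}` if `φ ∉ Φ` (`φ = (π φ)^+`). [cite: Liu2021, App. C (C.1) l. 4559–4563] -/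
theorem sigElt_apply (Φ : CMType E) (φ : E →+* ℂ) :
    V.sigElt Φ φ = if φ ∈ Φ.1 then (V.sig (restr F E φ)).2 else (V.sig (restr F E φ)).1 := by
  classical
  simp only [sigElt, Finsupp.coe_add, Pi.add_apply, Finsupp.coe_finsetSum, Finset.sum_apply,
    Finsupp.single_apply]
  by_cases hφ : φ ∈ Φ.1
  · rw [if_pos hφ]
    have h1 : ∀ τ : F →+* ℝ, CMType.aboveConj F E Φ τ ≠ φ := fun τ h =>
      (CMType.aboveConj_spec F E Φ τ).1 (h ▸ hφ)
    have h2 : ∀ τ : F →+* ℝ, CMType.above F E Φ τ = φ ↔ τ = restr F E φ := fun τ =>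
      ⟨fun h => by rw [← h, (CMType.above_spec F E Φ τ).2],
       fun h => (CMType.eq_above F E hφ h.symm).symm⟩
    simp only [h1, if_false, Finset.sum_const_zero, zero_add, h2, Finset.sum_ite_eq', Finset.mem_univ, if_true]
  · rw [if_neg hφ]
    have hφc : φ ∈ (CMType.conj E Φ).1 := hφ
    have h1 : ∀ τ : F →+* ℝ, CMType.above F E Φ τ ≠ φ := fun τ h => hφ (h ▸ (CMType.above_spec F E Φ τ).1)
    have h2 : ∀ τ : F →+* ℝ, CMType.aboveConj F E Φ τ = φ ↔ τ = restr F E φ := fun τ =>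
      ⟨fun h => by rw [← h, (CMType.aboveConj_spec F E Φ τ).2],
       fun h => by
        subst h
        exact (CMType.existsUnique_mem_restr_eq F E (CMType.conj E Φ) (restr F E φ)).unique
          (CMType.aboveConj_spec F E Φ (restr F E φ)) ⟨hφc, rfl⟩⟩
    simp only [h1, if_false, Finset.sum_const_zero, add_zero, h2, Finset.sum_ite_eq', Finset.mem_univ, if_true]

open Classical in
/-- **Coefficients of `sig^♭_{V,Φ}`**: `q_{π φ}` at `φ ∈ Φ`, `0` off `Φ`. [cite: Liu2021, App. C (C.1) l. 4559–4563] -/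
theorem sigFlatElt_apply (Φ : CMType E) (φ : E →+* ℂ) :
    V.sigFlatElt Φ φ = if φ ∈ Φ.1 then (V.sig (restr F E φ)).2 else 0 := by
  classical
  simp only [sigFlatElt, Finsupp.coe_finsetSum, Finset.sum_apply, Finsupp.single_apply]
  by_cases hφ : φ ∈ Φ.1
  · rw [if_pos hφ]
    have h2 : ∀ τ : F →+* ℝ, CMType.above F E Φ τ = φ ↔ τ = restr F E φ := fun τ =>
      ⟨fun h => by rw [← h, (CMType.above_spec F E Φ τ).2],
       fun h => (CMType.eq_above F E hφ h.symm).symm⟩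
    simp only [h2, Finset.sum_ite_eq', Finset.mem_univ, if_true]
  · rw [if_neg hφ]
    have h1 : ∀ τ : F →+* ℝ, CMType.above F E Φ τ ≠ φ := fun τ h => hφ (h ▸ (CMType.above_spec F E Φ τ).1)
    simp only [h1, if_false, Finset.sum_const_zero]

omit [NumberField F] in
/-- `p_τ ≤ n`: a `τ`-positive definite subspace has dimension at most `dim_E V = n`. [cite: Liu2021, App. C l. 4558] -/
theorem posIndex_le (τ : F →+* ℝ) : V.posIndex τ ≤ V.n := by
  refine csSup_le' ?_
  rintro k ⟨W, hW, -⟩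
  rw [← hW, ← V.finrank_eq]
  exact Submodule.finrank_le W

omit [NumberField F] in
/-- `q_τ ≤ n`. [cite: Liu2021, App. C l. 4558] -/
theorem negIndex_le (τ : F →+* ℝ) : V.negIndex τ ≤ V.n := by
  refine csSup_le' ?_
  rintro k ⟨W, hW, -⟩
  rw [← hW, ← V.finrank_eq]
  exact Submodule.finrank_le W

omit [NumberField F] in
/-- Membership in `U(V)(F)`: `g ∈ GL_n(E)` is an isometry iff `(c g)ᵀ J g = J` (tree `mem_unitaryGroupOfForm_iff`).
[cite: Liu2021, App. C l. 4569–4571] -/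
theorem mem_rationalPoints_iff (g : GL (Fin V.n) E) :
    g ∈ V.rationalPoints ↔ ((g : Matrix (Fin V.n) (Fin V.n) E).map (conj F E))ᵀ * V.gram * g = V.gram :=
  mem_unitaryGroupOfForm_iff

omit [NumberField F] in
/-- **The binder list of `HermSpace` is inhabited** (non-vacuity of the typing, our bookkeeping): the standard
split hermitian space `E^{⊕n}`, `(x, y) := Σ_i x_i c(y_i)`, for every `n ≥ 1`. [cite: Liu2021, App. C l. 4558] -/
theorem nonempty (n : ℕ) (hn : 1 ≤ n) : ∃ V : HermSpace F E, V.n = n := by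
  letI : IsCMField E := IsCMField.ofCMExtension F E
  refine ⟨{ V := (Fin n → E)
            n := n
            one_le_n := hn
            finrank_eq := Module.finrank_fin_fun E
            form := fun x y => ∑ i, x i * conj F E (y i)
            form_add_left := ?_
            form_smul_left := ?_
            form_herm := ?_
            form_nondeg := ?_ }, rfl⟩
  · intro x y z
    simp [add_mul, Finset.sum_add_distrib]
  · intro a x y
    simp [Finset.mul_sum, mul_assoc]
  · intro x y
    simp [map_sum, conj_apply, mul_comm]
  · intro x hx
    funext j
    have := hx (Pi.single j 1)
    simpa [Pi.single_apply, apply_ite (conj F E)] using this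

end HermSpace

end Literature.NumberTheory.Automorphic.Liu2021.AppendixC

end
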